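import Mathlib
import HarnessLib
import Literature.MathematicalPhysics.QuantumFieldTheory.UniformTorusClusteringProofs

/-!
# `CurvatureKernelBound` — strong-coupling torus clustering on the explicit coupling disc (support for stmt-QuantumFields-11687)

Crux `stmt-QuantumFields-11687` (`PencilRigidity.CurvatureKernelBound`), line `coupling-trichotomy`, stub
`StrongCouplingClusteringDiscExplicit`.

This is the explicit-radius form of the tree theorem `StrongCouplingClusteringDisc` (same namespace): that theorem hides the
strong-coupling radius behind `∃ β₀ > 0`, although its proof takes `β₀ := betaOne d ρ / 2`. The reshaped child stubs of the
crux are separated by the explicit threshold `|b| < betaOne 4 r.ρ / 2`, so the lattice side needs the radius named. The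
proof is the same replica-expansion argument: `PlaqSystem.norm_truncatedExpect_le` bounds the complex truncated correlation
by `K (‖β‖/r)^n` for `‖β‖ ≤ r := betaOne d ρ / 2`, and with `m := log (r/β')` one has `(‖β‖/r)^n ≤ (β'/r)^n = e^{−m n}` for
every `|β| ≤ β'`. [folklore]
-/

namespace Summit.QuantumFields.YangMills.Theorems.CurvatureKernel

open MeasureTheory Measure ProbabilityTheory Finset Filter
open scoped Topology
open Literature.MathematicalPhysics.QuantumFieldTheory
open Literature.MathematicalPhysics.QuantumLattice (configShift configShift_apply toTorusObservable
  IsCylinder LGConfig)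
open Literature.Probability.LatticeModels (Torus.proj Torus.proj_apply)
open Literature.Probability.LatticeModels.Site (supNorm supNorm_le_iff natAbs_le_supNorm
  exists_natAbs_eq_supNorm norm_eq_supNorm)

noncomputable section

/-- **Stub `StrongCouplingClusteringDiscExplicit`** (registered signature verbatim). Exponential clustering of the torus
Wilson states at strong coupling with ONE mass `m = log (betaOne d ρ / (2 β'))` and ONE constant `C(F₁, F₂)` for all
couplings `|β| ≤ β' < betaOne d ρ / 2`, all torus sides and all displacements of less than half the period (explicit-radius
form of `StrongCouplingClusteringDisc`, same proof: replica expansion of the torus plaquette system + Schwarz lemma).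
[folklore] -/
theorem StrongCouplingClusteringDiscExplicit : open Literature.MathematicalPhysics.QuantumLattice Literature.MathematicalPhysics.QuantumFieldTheory in ∀ (d N : ℕ) (G : Type) [Group G] [TopologicalSpace G] [IsTopologicalGroup G] [CompactSpace G] [T2Space G] [SecondCountableTopology G] [MeasurableSpace G] [BorelSpace G] (ρ : G →* Matrix (Fin N) (Fin N) ℂ), 2 ≤ d → Continuous ρ → ∀ β' : ℝ, 0 < β' → β' < betaOne d ρ / 2 → ∃ m : ℝ, 0 < m ∧ ∀ F₁ F₂ : LGConfig d G → ℝ, Literature.MathematicalPhysics.QuantumLattice.IsLocalObservable F₁ → Literature.MathematicalPhysics.QuantumLattice.IsLocalObservable F₂ → Measurable F₁ → Measurable F₂ → (∃ C, ∀ U, |F₁ U| ≤ C) → (∃ C, ∀ U, |F₂ U| ≤ C) → ∃ C : ℝ, ∀ β : ℝ, |β| ≤ β' → ∀ (L : ℕ) (x : Literature.Probability.LatticeModels.Site d), 2 * ‖x‖ < (L : ℝ) + 1 → |wilsonExpectation (L := L + 1) ρ β (toTorusObservable (L + 1) fun U => F₁ U * F₂ (configShift x U)) - wilsonExpectation (L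 := L + 1) ρ β (toTorusObservable (L + 1) F₁) * wilsonExpectation (L := L + 1) ρ β (toTorusObservable (L + 1) (F₂ ∘ configShift x))| ≤ C * Real.exp (-m * ‖x‖) := by
  intro d N G _ _ _ _ _ _ _ _ ρ hd hρ β' hβ'0 hβ'r
  classical
  haveI : NeZero d := ⟨by omega⟩
  -- the strong-coupling radius (explicit)
  set r : ℝ := betaOne d ρ / 2 with hrdef
  have hr : 0 < r := by have := betaOne_pos d (ρ := ρ); positivity
  have hrR : r < betaOne d ρ := by have := betaOne_pos d (ρ := ρ); rw [hrdef]; linarith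
  -- the mass, uniform on the closed coupling disc `|β| ≤ β'`
  set m : ℝ := Real.log (r / β') with hmdef
  have hm : 0 < m := Real.log_pos ((one_lt_div hβ'0).2 hβ'r)
  refine ⟨m, hm, fun F₁ F₂ hloc₁ hloc₂ h₁m h₂m hb₁ hb₂ => ?_⟩
  obtain ⟨B₁, hB₁⟩ := hloc₁
  obtain ⟨S₂, hS₂⟩ := hloc₂
  obtain ⟨C₁, hC₁⟩ := hb₁
  obtain ⟨C₂, hC₂⟩ := hb₂
  have hC₁0 : 0 ≤ C₁ := (abs_nonneg _).trans (hC₁ fun _ => 1)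
  have hC₂0 : 0 ≤ C₂ := (abs_nonneg _).trans (hC₂ fun _ => 1)
  -- the constants
  set c : ℕ := bondRadius B₁ + bondRadius S₂ + 2 with hcdef
  set sB : ℕ := (B₁.card + S₂.card) * (2 ^ d * (d * d)) with hsB
  set κ : ℝ := 2 * Real.exp (1 / 2) with hκ
  have hκ1 : 1 ≤ κ := by
    rw [hκ]; have := Real.one_lt_exp_iff.2 (by norm_num : (0 : ℝ) < 1 / 2); linarith
  set Kunif : ℝ := C₁ * C₂ * κ ^ sB + C₁ * κ ^ sB * (C₂ * κ ^ sB) with hKunif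
  have hKunif0 : 0 ≤ Kunif := by positivity
  refine ⟨Kunif * Real.exp (m * c), fun β hββ' L x hx => ?_⟩
  -- the torus system of side `L + 1`
  set L' : ℕ := L + 1 with hL'
  have hR : (torusSystem (d := d) (G := G) ρ L').Regular (costBound ρ) (Plaq.degBound d) :=
    torusSystem_regular ρ hρ
  set X₀ : ℕ := supNorm x with hX₀
  have hxn : ‖x‖ = (X₀ : ℝ) := norm_eq_supNorm x
  have hx' : 2 * X₀ < L' := by
    have h : (2 : ℝ) * X₀ < (L : ℝ) + 1 := by rwa [hxn] at hx
    exact_mod_cast h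
  -- the twisted observables
  set Φ₁ : ZdGaugeConfig d G → ℂ := fun U => (F₁ (U ∘ torusRed L') : ℂ) with hΦ₁
  set Φ₂ : ZdGaugeConfig d G → ℂ := fun U => (F₂ (configShift x (U ∘ torusRed L')) : ℂ) with hΦ₂
  set B₂ : Finset (ZdEdge d) := S₂.image fun e => (e.1 - x, e.2) with hB₂
  have hΦ₁m : Measurable Φ₁ :=
    Complex.measurable_ofReal.comp (h₁m.comp (measurable_comp_relabel (torusRed L')))
  have hΦ₂m : Measurable Φ₂ :=
    Complex.measurable_ofReal.comp ((h₂m.comp (configShift x).measurable).comp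
      (measurable_comp_relabel (torusRed L')))
  have hΦ₁b : ∀ U, ‖Φ₁ U‖ ≤ C₁ := fun U => by
    rw [hΦ₁, Complex.norm_real, Real.norm_eq_abs]; exact hC₁ _
  have hΦ₂b : ∀ U, ‖Φ₂ U‖ ≤ C₂ := fun U => by
    rw [hΦ₂, Complex.norm_real, Real.norm_eq_abs]; exact hC₂ _
  have hΦ₁d : DependsOn Φ₁ ((B₁.image (torusRed L') : Finset (ZdEdge d)) : Set (ZdEdge d)) :=
    dependsOn_comp_torusRed L' (F := fun U => (F₁ U : ℂ)) fun U V h => by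
      show (F₁ U : ℂ) = F₁ V; rw [hB₁ h]
  have hΦ₂d : DependsOn Φ₂ ((B₂.image (torusRed L') : Finset (ZdEdge d)) : Set (ZdEdge d)) := by
    have h := IsCylinder.comp_configShift hS₂ x
    exact dependsOn_comp_torusRed L' (F := fun U => ((F₂ ∘ configShift x) U : ℂ)) fun U V h' => by
      show (((F₂ ∘ configShift x) U : ℝ) : ℂ) = ((F₂ ∘ configShift x) V : ℝ); rw [h h']
  -- step 1: the real truncated correlation is dominated by the complex one
  refine (abs_truncated_le_norm_expect ρ hρ β L' h₁m h₂m hC₁ hC₂ x).trans ?_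
  change ‖(torusSystem ρ L').expect (fun U => Φ₁ U * Φ₂ U) (torusGenuine d L') β -
      (torusSystem ρ L').expect Φ₁ (torusGenuine d L') β *
        (torusSystem ρ L').expect Φ₂ (torusGenuine d L') β‖ ≤ Kunif * Real.exp (m * c) *
    Real.exp (-m * ‖x‖)
  -- seed counts, uniformly in `L` and `x`
  have hs₁ : ((torusSystem (G := G) ρ L').seedsOf (B₁.image (torusRed L'))).card ≤ sB := by
    refine (card_seedsOf_torusSystem_le ρ B₁).trans ((card_seedsOf_le_mul B₁).trans ?_)
    rw [hsB]; exact Nat.mul_le_mul_right _ (Nat.le_add_right _ _)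
  have hB₂c : B₂.card ≤ S₂.card := Finset.card_image_le
  have hs₂ : ((torusSystem (G := G) ρ L').seedsOf (B₂.image (torusRed L'))).card ≤ sB := by
    refine (card_seedsOf_torusSystem_le ρ B₂).trans ((card_seedsOf_le_mul B₂).trans ?_)
    rw [hsB]; exact Nat.mul_le_mul_right _ (hB₂c.trans (Nat.le_add_left _ _))
  have hs₁₂ : ((torusSystem (G := G) ρ L').seedsOf
      (B₁.image (torusRed L') ∪ B₂.image (torusRed L'))).card ≤ sB := by
    rw [← Finset.image_union]
    refine (card_seedsOf_torusSystem_le ρ _).trans ((card_seedsOf_le_mul _).trans ?_)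
    rw [hsB]
    exact Nat.mul_le_mul_right _ ((Finset.card_union_le _ _).trans (Nat.add_le_add_left hB₂c _))
  have hK : C₁ * C₂ * κ ^ ((torusSystem (G := G) ρ L').seedsOf
        (B₁.image (torusRed L') ∪ B₂.image (torusRed L'))).card +
      C₁ * κ ^ ((torusSystem (G := G) ρ L').seedsOf (B₁.image (torusRed L'))).card *
        (C₂ * κ ^ ((torusSystem (G := G) ρ L').seedsOf (B₂.image (torusRed L'))).card) ≤ Kunif := by
    rw [hKunif]
    refine add_le_add (mul_le_mul_of_nonneg_left (pow_le_pow_right₀ hκ1 hs₁₂) (by positivity))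
      (mul_le_mul (mul_le_mul_of_nonneg_left (pow_le_pow_right₀ hκ1 hs₁) hC₁0)
        (mul_le_mul_of_nonneg_left (pow_le_pow_right₀ hκ1 hs₂) hC₂0) (by positivity)
        (by positivity))
  -- the coupling in the closed disc `|β| ≤ β' < r` (negative couplings included)
  have hβn' : ‖(β : ℂ)‖ ≤ β' := by rw [Complex.norm_real, Real.norm_eq_abs]; exact hββ'
  have hβn : ‖(β : ℂ)‖ ≤ r := hβn'.trans hβ'r.le
  have hβR : ‖(β : ℂ)‖ ≤ PlaqSystem.betaR (costBound ρ) (Plaq.degBound d) := by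
    rw [betaR_costBound]; exact hβn.trans hrR.le
  have hexp : Real.exp (m * c) * Real.exp (-m * ‖x‖) = Real.exp (m * c - m * X₀) := by
    rw [← Real.exp_add, hxn]; ring_nf
  by_cases hfar : c < X₀
  · -- far displacements: disjoint supports, long joining polymers
    have hdisj : Disjoint (B₁.image (torusRed L')) (B₂.image (torusRed L')) :=
      disjoint_image_torusRed (by rw [hcdef] at hfar; omega) hx'
    have hn : ∀ Q, Q ⊆ torusGenuine d L' →
        (torusSystem (G := G) ρ L').Joins Q (B₁.image (torusRed L')) (B₂.image (torusRed L')) →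
        X₀ - c ≤ Q.card := by
      intro Q _ hJ
      have h := PlaqSystem.le_card_of_joins (S := torusSystem (G := G) ρ L')
        (fun p => tdist L' originPlaq p)
        (fun u v huv => tdist_le_of_tadj originPlaq ((torusSystem_adj_iff ρ).1 huv))
        (a := bondRadius B₁ + 1) (b := X₀ - bondRadius S₂ - 1)
        (fun p hp => by
          obtain ⟨y, rfl, hy⟩ := (touches_torusSystem_iff ρ B₁ p).1 hp
          exact tdist_le_of_touches hy)
        (fun q hq => by
          obtain ⟨y, rfl, hy⟩ := (touches_torusSystem_iff ρ B₂ q).1 hq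
          exact le_tdist_of_touches_shift hy hx') hJ
      rw [hcdef]; omega
    have hbound := PlaqSystem.norm_truncatedExpect_le hR hΦ₁m hΦ₂m hΦ₁b hΦ₂b hΦ₁d hΦ₂d hdisj
      (torusGenuine d L') hn hr (by rwa [betaR_costBound]) hβn
    refine hbound.trans ?_
    -- the decay factor, uniformly on the disc: `(‖β‖/r)^n ≤ (β'/r)^n = e^{-m n}`
    have hdec : (‖(β : ℂ)‖ / r) ^ (X₀ - c) ≤ Real.exp (-(m * ((X₀ - c : ℕ) : ℝ))) := by
      have h1 : (‖(β : ℂ)‖ / r) ^ (X₀ - c) ≤ (β' / r) ^ (X₀ - c) :=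
        pow_le_pow_left₀ (by positivity) (div_le_div_of_nonneg_right hβn' hr.le) _
      have h2 := pow_div_le_exp_neg hβ'0.le hr (X₀ - c)
      rw [if_neg hβ'0.ne', ← hmdef] at h2
      exact h1.trans h2
    calc _ ≤ Kunif * Real.exp (-(m * ((X₀ - c : ℕ) : ℝ))) :=
          mul_le_mul hK hdec (by positivity) hKunif0
      _ = Kunif * Real.exp (m * c) * Real.exp (-m * ‖x‖) := by
          rw [mul_assoc, hexp, Nat.cast_sub hfar.le]; ring_nf
  · -- near displacements: the crude bound
    push Not at hfar
    have hbound := PlaqSystem.norm_truncatedExpect_le_const hR hβR hΦ₁m hΦ₂m hΦ₁b hΦ₂b hΦ₁d hΦ₂d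
      (torusGenuine d L')
    refine (hbound.trans hK).trans ?_
    rw [mul_assoc, hexp]
    have h1 : (1 : ℝ) ≤ Real.exp (m * c - m * X₀) := by
      refine Real.one_le_exp ?_
      have : (X₀ : ℝ) ≤ c := by exact_mod_cast hfar
      nlinarith
    nlinarith

end

end Summit.QuantumFields.YangMills.Theorems.CurvatureKernel
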